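import Literature.NumberTheory.EllipticCurves.Rank1Residual.Typed.X6
import Literature.NumberTheory.EllipticCurves.Rank1Residual.Typed.X7
import Literature.NumberTheory.EllipticCurves.Rank1Residual.Typed.X8
import Literature.NumberTheory.EllipticCurves.Isogeny
import HarnessLib

/-!
# Rung K3 of ladder BSD — the CLOSED LEAF `SignedSupersingular` (cell `bsd-ssimc`, HUMAN RULINGS D-0059 / D-0061)

HONEST FRAMING (cell `bsd-ssimc`, run/shared/lean/pub/bsd-ssimc/): this file STATES the target of
rung K3 ("signed supersingular Iwasawa main conjecture, non-CM, any level") as ONE closed `Prop`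
over existing tree declarations — nothing is asserted, nothing is booked. It is the ∀-closure of the
three TYPED missing inputs of the supersingular corners of the kernel partition
(`Partition/CornersAll.lean` `bsdp_allCurves_of_not_corner_of_not_cornerF`, hypotheses
`¬ (ClassX6 W p ∧ r_an = 0)`, `¬ ClassX7 W p`, `¬ ClassX8 W p`, read under `¬ W.HasCM` and `p ≠ 2`):

* corner **X6 ∧ r = 0** (semistable, good supersingular odd `p`, `p ≥ 5 ∨ a_3 = 0`; RESIDUAL-MAP
  row A6/N4): `Typed.X6.MissingInputAt W p` — in rank `0` at odd `p` this IS the Eisenstein half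
  `MissingLowerBoundAt W p` (`X6.missingInputAt_iff_missingLowerBoundAt_of_analyticRank_eq_zero`);
* corner **X7** (good supersingular `p`, `E` NOT semistable; rows A7 = N5/O4): `Typed.X7.MissingInputAt W p`;
* corner **X8** (`p = 3`, good supersingular, `a_3 = ±3`; rows A8 = N6/O3): `Typed.X8.MissingInputAt W p`.

The rung is NON-CM and at ODD `p`: CM curves are the partition's `CornerF` axis (rungs K7/K8) and
`p = 2` is rung K4 (`ClassX5`), so both are excluded by hypothesis exactly as in the partition
theorem. Granted the standing published facts (GZK, modularity, Wuthrich 2014 Prop. 21) the leaf gives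
Miller's `BSD(E,p)` on the three corners (`bsdp_of_signedSupersingular`, via
`X6/X7/X8.bsdp_of_missingInputAt`); conversely `BSD(E,p)` at a pair gives each typed missing input
(`Typed.missingPPartAt_of_bsdp`), so the leaf is the corners' `BSD(E,p)` and nothing more. PRE / unrefereed inputs
(BSTW arXiv:2409.01350 Thm. II.1.18, Sprung 2024 Conj. 3.33, Kim 2025) are NOT baked in: they are
cruxes of the ledger route that closes this leaf (`ledger route open … --closes-target
Summit.BirchSwinnertonDyer.Rank1Residual.Supersingular.SignedSupersingular`, label «closes rung K3
of BirchSwinnertonDyer»). References: HOME/TARGET.md (cell bsd-ssimc) §1.1–§1.3;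
`Partition/CornersAll.lean`; `Typed/X6.lean`, `Typed/X7.lean`, `Typed/X8.lean`.
-/

noncomputable section

open scoped Classical

open WeierstrassCurve Literature.NumberTheory.EllipticCurves
  Literature.NumberTheory.EllipticCurves.Rank1Residual
  Literature.NumberTheory.EllipticCurves.Rank1Residual.Typed
  Literature.NumberTheory.EllipticCurves.Wuthrich2014

namespace Summit.BirchSwinnertonDyer.Rank1Residual.Supersingular

/-- **Rung K3 — `SignedSupersingular` (OPEN; construction-shaped; the CLOSED LEAF of ladder BSD rung
K3).** "For every NON-CM elliptic curve `E/ℚ` (globally minimal `W`) of analytic rank `≤ 1` and every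
ODD prime `p`: if `(W, p)` lies in corner X6 with `r_an = 0`, in corner X7, or in corner X8 of the
kernel partition, then the TYPED missing input of that corner holds at `(W, p)`." Nothing asserted;
no published theorem proves any of the three clauses class-wide (Kobayashi's signed main conjecture
is open off CM / square-free level in print: BSTW arXiv:2409.01350 is PRE; Sprung, Adv. Math. 449
(2024) Thm. 1.1 is conditional on his Conj. 3.33; Kim 2025 is PRE). [folklore] -/
@[conjecture] def SignedSupersingular : Prop :=
  ∀ (W : WeierstrassCurve ℚ) [W.IsElliptic] [W.IsGloballyMinimal] (p : ℕ) [Fact p.Prime],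
    W.analyticRank ≤ 1 → ¬ W.HasCM → p ≠ 2 →
      (ClassX6 W p → W.analyticRank = 0 → X6.MissingInputAt W p) ∧
      (ClassX7 W p → X7.MissingInputAt W p) ∧
      (ClassX8 W p → X8.MissingInputAt W p)

variable (W : WeierstrassCurve ℚ) [W.IsElliptic] [W.IsGloballyMinimal] (p : ℕ) [Fact p.Prime]

/-- **Forward bookkeeping: the leaf closes the three supersingular corners.** Granted the standing
published facts Wuthrich 2014 Prop. 21 (`hW`), GZK (`hGZK`) and modularity (`hmod`), the leaf gives
Miller's `BSD(E,p)` on corner X6 ∧ r = 0, on corner X7 and on corner X8 (non-CM, odd `p`,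
`r_an ≤ 1`) — exactly the three hypotheses `¬ (ClassX6 ∧ r = 0)`, `¬ ClassX7`, `¬ ClassX8` of
`bsdp_allCurves_of_not_corner_of_not_cornerF`. [cite: Wuthrich2014, Prop. 21 (p. 400)]
[cite: Miller2011LMS, §1 and Def. 1.1] -/
theorem bsdp_of_signedSupersingular (hS : SignedSupersingular) (hW : sha_dvd_analyticSha)
    (hGZK : rank_eq_analyticRank_of_analyticRank_le_one) (hmod : hasEntireLFunction_rat)
    (hr : W.analyticRank ≤ 1) (hcm : ¬ W.HasCM) (hp : p ≠ 2) :
    (ClassX6 W p → W.analyticRank = 0 → BSDp W p) ∧ (ClassX7 W p → BSDp W p) ∧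
      (ClassX8 W p → BSDp W p) := by
  obtain ⟨h6, h7, h8⟩ := hS W p hr hcm hp
  refine ⟨fun hX h0 ↦ ?_, fun hX ↦ ?_, fun hX ↦ ?_⟩
  · exact X6.bsdp_of_missingInputAt hW hGZK hmod W p hr hX (h6 hX h0)
  · exact X7.bsdp_of_missingInputAt hW hGZK hmod W p hr hX (h7 hX)
  · exact X8.bsdp_of_missingInputAt hW hGZK hmod W p hr hX (h8 hX)

end Summit.BirchSwinnertonDyer.Rank1Residual.Supersingular

end
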